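import Summits.QuantumFields.BalabanUV.T4Continuum.Support.RegionCornerCoupling

/-!
# T⁴ programme, spine node NE2 (U1a), sub-row Δ1 «NE2⁰-Dirichlet» — THE CORNER BOUNDS ARE SHARP: at an exterior site with `m ≥ 2`
# neighbours in `Ω` the corner form attains `+n²` and `−(m − 1)·n²` per unit mass, so `n² ≤ ‖C‖`, `(m − 1)·n² ≤ ‖C‖`, and
# `C = 0 ↔ AtMostOneNeighbour` (`2 ≤ n`, any union of blocks)

NE2 formalisation swarm `b2b-balaban-t4-ne2-formalise-*`, LEAF PROVER 02 (gen 9), support item «Δ1-CORNER-COUPLING», file 5 (files 1–2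
`Support/RegionExteriorFlux` / `Support/RegionCornerCoupling`: `−(d − 1)·n²·Σ_corner ≤ re⟨A, C A⟩ ≤ n²·Σ_corner`, `‖C‖ ≤ (d − 1)·n²`).  The crew's
numerics (leaf-07-g10, memo `t4/T4-EST-NE2-D1-REENTRANT.md` v1, two engines, d = 2) measure `‖cornerC‖ = n²` EXACTLY on every re-entrant
geometry; THIS FILE makes the lower bounds kernel facts, with explicit test fields on the bonds attached to ONE exterior site `x ∉ Ω`:

 * §1 `bondAt x i` — the bond attached to `x` via (direction, sign) —, `sgnB i = ∓1`, `divTerm = sgnB·n·ιA(bondAt)`; for `i ∈ nbrIn x` the bond is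
   a star bond (`star_bondAt`) with boundary indicator `bdW 1 = 1` (`bdW_one_bondAt`, `2 ≤ n` not needed); and the geometric injectivity
   **`bondAt_inj`**: `bondAt x′ i′ = bondAt x i` with `x, x′ ∉ Ω`, `i ∈ nbrIn x` forces `x′ = x ∧ i′ = i`.
 * §2 the test field `testField x c = Σ_{i ∈ nbrIn x} c_i·e_{bondAt x i}` and its three sums: `nsq = Σ‖c_i‖²`, own-direction charge `Σ‖c_i‖²`
   (`2 ≤ n`), `extFlux = n²·‖Σ_i sgnB i·c_i‖²` (only the site `x` sees the field); hence **`re_form_cornerC_testField`**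
   `re⟨A, C A⟩ = n²·(Σ_i ‖c_i‖² − ‖Σ_i sgnB i·c_i‖²)`.
 * §3 THE ENDS (`2 ≤ n`, `x ∉ Ω`, `m = nbrCount x`): `c = sgnB` gives `re⟨A, C A⟩ = −(m − 1)·n²·‖A‖²` (**`re_form_cornerC_signField`**); for `m ≥ 2`
   two opposite signs give `re⟨A, C A⟩ = +n²·‖A‖²` (**`re_form_cornerC_dipole`**); so **`le_opNorm_cornerC`** `n² ≤ ‖C‖`,
   **`mul_le_opNorm_cornerC`** `(m − 1)·n² ≤ ‖C‖`, and **`cornerC_eq_zero_iff : cornerC n M S = 0 ↔ AtMostOneNeighbour n M S`** — the local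
   electric operator is componentwise EXACTLY on the regions without re-entrant contact (file 6's `cornerC_eq_zero` is the reverse direction).

HONEST FRAMING (T4-DAG p. 1).  Lattice bookkeeping at MODEL level (`U = 1`, ONE region, finite torus) for the tree's STAR-BOND (electric) local
operator; under the literal Dirichlet compression of [B9] (3.27) (dictionary fork G-ne2p1-g15-6, owner R44) there is no corner coupling at all —
nothing here decides that fork; statements OURS ([folklore]); no tower / W2 / Hessian budget on re-entrant regions; Δ1 NOT closed; NE2 (U1a) NOT
proved; spine PROVED 0/9 unchanged; NOT [B9] (3.16)/(3.23)–(3.27) as printed; NOT infinite volume, NOT a mass gap, NOT the Clay problem.  HONEST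
DEPENDENCY: continuum YM on T⁴ ⇐ BetaPertH ∧ nine spine estimates (0/9 proved); BetaPertH ⇐ (D1) ∧ (D4) ∧ CAP+tail; G-an2-4 gates asym, D1 and
NE2/3/4.  No `sorry`.
-/

noncomputable section

open scoped BigOperators ComplexConjugate Matrix Matrix.Norms.L2Operator
open Finset

namespace Summit.QuantumFields.BalabanUV.T4Continuum.RegionCornerCouplingSharp

open Literature.MathematicalPhysics.QuantumFieldTheory.Balaban1983to89.B5Prop11Plancherel (Tor fine unitVec)
open Literature.MathematicalPhysics.QuantumFieldTheory.Balaban1983to89.B5Prop11Lower (nsq nsq_nonneg star_dotProduct_self nsq_mulVec_le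
  norm_star_dotProduct_le)
open Summit.QuantumFields.BalabanUV.T4Continuum
open Summit.QuantumFields.BalabanUV.T4Continuum.SubtypeCompression (ext ext_apply_of ext_apply_of_not)
open Summit.QuantumFields.BalabanUV.T4Continuum.RegionGaugeFixedVector (starReg)
open Summit.QuantumFields.BalabanUV.T4Continuum.RegionGaffneyIdentity (extFlux)
open Summit.QuantumFields.BalabanUV.T4Continuum.RegionStarBoundaryCharges (nbr AtMostOneNeighbour)
open Summit.QuantumFields.BalabanUV.T4Continuum.RegionElectricSplitting (cnt1)
open Summit.QuantumFields.BalabanUV.T4Continuum.RegionElectricGeneral (cornerC cornerC_eq_zero)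
open Summit.QuantumFields.BalabanUV.T4Continuum.RegionExteriorFlux
open Summit.QuantumFields.BalabanUV.T4Continuum.RegionCornerCoupling (cornerWt re_form_cornerC cnt1_own_eq_bdW)
open Summit.QuantumFields.BalabanUV.Beta.GAN24.DirichletBoxTrace (blockReg)

variable {d : ℕ}

section Region

variable (n : ℕ) [NeZero n] (M : Fin d → ℕ) [hM : ∀ μ, NeZero (M μ)] (S : Tor M → Prop) [DecidablePred S]

/-! ## §1 The bonds attached to a site -/

/-- the bond attached to `x` via (direction, sign): `(x, μ)` forwards, `(x − e_μ, μ)` backwards. [folklore] -/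
def bondAt (x : Tor (fine n M)) (i : Fin d × Bool) : Tor (fine n M) × Fin d :=
  if i.2 then (x, i.1) else (x - unitVec (fine n M) i.1, i.1)

/-- the sign with which the attached bond feeds the divergence at `x`: `−1` forwards (tail at `x`), `+1` backwards (head at `x`). [folklore] -/
def sgnB (i : Fin d × Bool) : ℂ := if i.2 then -1 else 1

omit [DecidablePred S] in
/-- `‖sgnB i‖ = 1`. [folklore] -/
theorem norm_sgnB (i : Fin d × Bool) : ‖sgnB i‖ = 1 := by
  unfold sgnB; split_ifs <;> simp

omit [DecidablePred S] in
/-- `sgnB i · sgnB i = 1`. [folklore] -/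
theorem sgnB_mul_self (i : Fin d × Bool) : sgnB i * sgnB i = 1 := by
  unfold sgnB; split_ifs <;> norm_num

/-- file 1's `divTerm` through the attached bond: `divTerm A x i = sgnB i·n·ιA(bondAt x i)`. [folklore] -/
theorem divTerm_eq (A : {b // starReg n M S b} → ℂ) (x : Tor (fine n M)) (i : Fin d × Bool) :
    divTerm n M S A x i = sgnB i * (n : ℂ) * ext (starReg n M S) A (bondAt n M x i) := by
  unfold divTerm sgnB bondAt
  split_ifs <;> ring

/-- for `i ∈ nbrIn x` the attached bond is a star bond (its other endpoint lies in `Ω`). [folklore] -/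
theorem star_bondAt {x : Tor (fine n M)} {i : Fin d × Bool} (hi : i ∈ nbrIn n M S x) : starReg n M S (bondAt n M x i) := by
  rw [mem_nbrIn] at hi
  obtain ⟨μ, b⟩ := i
  cases b
  · simp only [bondAt, Bool.false_eq_true, if_false]
    exact Or.inl (by simpa [nbr] using hi)
  · simp only [bondAt, if_true]
    exact Or.inr (by simpa [nbr] using hi)

/-- … and, if `x ∉ Ω`, it has exactly one exterior endpoint: `bdW 1 (bondAt x i) = 1`. [folklore] -/
theorem bdW_one_bondAt {x : Tor (fine n M)} (hx : ¬ blockReg n M S x) {i : Fin d × Bool} (hi : i ∈ nbrIn n M S x) :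
    bdW n M S (fun _ => (1 : ℝ)) (bondAt n M x i) = 1 := by
  rw [mem_nbrIn] at hi
  obtain ⟨μ, b⟩ := i
  cases b
  · have h1 : blockReg n M S (x - unitVec (fine n M) μ) := by simpa [nbr] using hi
    simp only [bdW, bondAt, Bool.false_eq_true, if_false, sub_add_cancel]
    rw [if_neg hx, if_pos h1, add_zero]
  · have h1 : blockReg n M S (x + unitVec (fine n M) μ) := by simpa [nbr] using hi
    simp only [bdW, bondAt, if_true]
    rw [if_pos h1, if_neg hx, zero_add]

omit [DecidablePred S] in
/-- **GEOMETRIC INJECTIVITY**: a bond attached to an exterior site `x′` and a bond attached to an exterior site `x` via an `Ω`-neighbour coincide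
only when `x′ = x` and the attachments agree. [folklore] -/
theorem bondAt_inj [DecidablePred S] {x x' : Tor (fine n M)} (hx' : ¬ blockReg n M S x') {i i' : Fin d × Bool}
    (hi : i ∈ nbrIn n M S x) (h : bondAt n M x' i' = bondAt n M x i) : x' = x ∧ i' = i := by
  rw [mem_nbrIn] at hi
  obtain ⟨μ, b⟩ := i
  obtain ⟨μ', b'⟩ := i'
  cases b <;> cases b'
  · -- backwards / backwards: `x′ − e = x − e`
    simp only [bondAt, Bool.false_eq_true, if_false, Prod.mk.injEq] at h
    obtain ⟨h1, h2⟩ := h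
    subst μ'
    exact ⟨sub_left_injective h1, rfl⟩
  · -- i backwards (bond `(x − e, μ)`), i′ forwards (bond `(x′, μ′)`): `x′ = x − e ∈ Ω`, contradiction
    simp only [bondAt, Bool.false_eq_true, if_false, if_true, Prod.mk.injEq] at h
    obtain ⟨h1, h2⟩ := h
    subst μ'
    have : blockReg n M S x' := by rw [h1]; simpa [nbr] using hi
    exact absurd this hx'
  · -- i forwards (bond `(x, μ)`), i′ backwards (bond `(x′ − e, μ′)`): `x′ = x + e ∈ Ω`, contradiction
    simp only [bondAt, Bool.false_eq_true, if_false, if_true, Prod.mk.injEq] at h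
    obtain ⟨h1, h2⟩ := h
    subst μ'
    have e : x' = x + unitVec (fine n M) μ := by rw [← h1, sub_add_cancel]
    have : blockReg n M S x' := by rw [e]; simpa [nbr] using hi
    exact absurd this hx'
  · -- forwards / forwards: `x′ = x`
    simp only [bondAt, if_true, Prod.mk.injEq] at h
    obtain ⟨h1, h2⟩ := h
    subst μ'
    exact ⟨h1, rfl⟩

/-- the boundary indicator is TILED by the corner weight and file 1's isolated density: `cornerWt b + bdW [nbrCount ≤ 1] b = bdW 1 b` (every bond,
every `n`; the NE5 cross-reader's identity K3 of C-ne5leaf02-49, recorded for the consumers of files 1–2). [folklore] -/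
theorem cornerWt_add_isolated (b : Tor (fine n M) × Fin d) :
    cornerWt n M S b + bdW n M S (fun x => if nbrCount n M S x ≤ 1 then (1 : ℝ) else 0) b = bdW n M S (fun _ => 1) b := by
  simp only [cornerWt, bdW]
  split_ifs <;> norm_num <;> omega

/-! ## §2 The test field on the bonds attached to one exterior site -/

/-- THE TEST FIELD `Σ_{i ∈ nbrIn x} c_i·e_{bondAt x i}` on the star bonds. [folklore] -/
def testField (x : Tor (fine n M)) (c : Fin d × Bool → ℂ) : {b // starReg n M S b} → ℂ :=
  fun y => ∑ i ∈ nbrIn n M S x, if y.1 = bondAt n M x i then c i else 0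

/-- the zero extension of the test field at a bond attached to an exterior site `x′`: `c_{i′}` if `x′ = x` and `i′ ∈ nbrIn x`, else `0`.
[folklore] -/
theorem ext_testField_bondAt {x x' : Tor (fine n M)} (hx' : ¬ blockReg n M S x') (c : Fin d × Bool → ℂ) (i' : Fin d × Bool) :
    ext (starReg n M S) (testField n M S x c) (bondAt n M x' i')
      = if x' = x ∧ i' ∈ nbrIn n M S x then c i' else 0 := by
  by_cases hs : starReg n M S (bondAt n M x' i')
  · rw [ext_apply_of _ _ ⟨_, hs⟩]
    unfold testField
    simp only
    split_ifs with h
    · obtain ⟨rfl, hi'⟩ := h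
      rw [sum_eq_single i' (fun j hj hne => if_neg fun e => hne ((bondAt_inj n M S hx' hj e).2).symm) (fun h => absurd hi' h), if_pos rfl]
    · refine sum_eq_zero fun j hj => if_neg fun e => h ?_
      obtain ⟨rfl, rfl⟩ := bondAt_inj n M S hx' hj e
      exact ⟨rfl, hj⟩
  · rw [ext_apply_of_not _ _ hs, eq_comm]
    split_ifs with h
    · obtain ⟨rfl, hi'⟩ := h
      exact absurd (star_bondAt n M S hi') hs
    · rfl

/-- the exterior divergence of the test field: `n·Σ_{i ∈ nbrIn x} sgnB i·c_i` at `x`, `0` at every other exterior site. [folklore] -/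
theorem divS_ext_testField {x x' : Tor (fine n M)} (hx' : ¬ blockReg n M S x') (c : Fin d × Bool → ℂ) :
    Literature.MathematicalPhysics.QuantumFieldTheory.Balaban1983to89.B5Action121.divS (fine n M) (n : ℂ)
        (ext (starReg n M S) (testField n M S x c)) x'
      = if x' = x then (n : ℂ) * ∑ i ∈ nbrIn n M S x, sgnB i * c i else 0 := by
  rw [divS_ext_eq_sum]
  simp only [divTerm_eq, ext_testField_bondAt n M S hx']
  split_ifs with h
  · subst h
    simp only [true_and, mul_ite, mul_zero]
    rw [← Finset.sum_filter, Finset.filter_mem_eq_inter, Finset.univ_inter, mul_sum]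
    exact sum_congr rfl fun i _ => by ring
  · simp only [h, false_and, if_false, mul_zero, sum_const_zero]

/-- **THE EXTERIOR FLUX OF THE TEST FIELD**: `extFlux = n²·‖Σ_{i ∈ nbrIn x} sgnB i·c_i‖²` (`x ∉ Ω`). [folklore] -/
theorem extFlux_testField {x : Tor (fine n M)} (hx : ¬ blockReg n M S x) (c : Fin d × Bool → ℂ) :
    extFlux n M S (testField n M S x c) = (n : ℝ) ^ 2 * ‖∑ i ∈ nbrIn n M S x, sgnB i * c i‖ ^ 2 := by
  rw [extFlux_eq_sum_divS, Finset.sum_eq_single (⟨x, hx⟩ : {x // ¬ blockReg n M S x})]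
  · rw [divS_ext_testField n M S hx, if_pos rfl, norm_mul, Complex.norm_natCast, mul_pow]
  · intro x' _ hne
    rw [divS_ext_testField n M S x'.2, if_neg (fun e => hne (Subtype.ext e)), norm_zero, zero_pow two_ne_zero]
  · exact fun h => absurd (mem_univ _) h

/-- a star-bond sum of a function supported on ONE star bond. [folklore] -/
theorem sum_star_single {b₀ : Tor (fine n M) × Fin d} (hb₀ : starReg n M S b₀) (g : ℝ) :
    ∑ y : {b // starReg n M S b}, (if y.1 = b₀ then g else 0) = g := by
  rw [Finset.sum_eq_single (⟨b₀, hb₀⟩ : {b // starReg n M S b}) (fun y _ hne => if_neg fun e => hne (Subtype.ext e))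
    (fun h => absurd (mem_univ _) h), if_pos rfl]

/-- the value of the test field on a star bond: `c_i` on `bondAt x i` (`i ∈ nbrIn x`), `0` elsewhere — as a norm identity
`‖A y‖² = Σ_{i ∈ nbrIn x} [y = bondAt x i]·‖c_i‖²`. [folklore] -/
theorem norm_testField_sq {x : Tor (fine n M)} (hx : ¬ blockReg n M S x) (c : Fin d × Bool → ℂ) (y : {b // starReg n M S b}) :
    ‖testField n M S x c y‖ ^ 2 = ∑ i ∈ nbrIn n M S x, (if y.1 = bondAt n M x i then ‖c i‖ ^ 2 else 0) := by
  unfold testField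
  by_cases hex : ∃ i ∈ nbrIn n M S x, y.1 = bondAt n M x i
  · obtain ⟨i₀, hi₀, e₀⟩ := hex
    have huniq : ∀ j ∈ nbrIn n M S x, j ≠ i₀ → y.1 ≠ bondAt n M x j := fun j hj hne e =>
      hne (bondAt_inj n M S hx hi₀ (e.symm.trans e₀ ▸ rfl : bondAt n M x j = bondAt n M x i₀) |>.2) |> id
    rw [sum_eq_single i₀ (fun j hj hne => if_neg (huniq j hj hne)) (fun h => absurd hi₀ h), if_pos e₀,
      sum_eq_single i₀ (fun j hj hne => if_neg (huniq j hj hne)) (fun h => absurd hi₀ h), if_pos e₀]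
  · push Not at hex
    rw [sum_eq_zero fun j hj => if_neg (hex j hj), sum_eq_zero fun j hj => if_neg (hex j hj), norm_zero, zero_pow two_ne_zero]

/-- **`‖A‖² = Σ_i ‖c_i‖²`** for the test field (`x ∉ Ω`). [folklore] -/
theorem nsq_testField {x : Tor (fine n M)} (hx : ¬ blockReg n M S x) (c : Fin d × Bool → ℂ) :
    nsq (testField n M S x c) = ∑ i ∈ nbrIn n M S x, ‖c i‖ ^ 2 := by
  unfold nsq
  rw [sum_congr rfl fun y _ => norm_testField_sq n M S hx c y, sum_comm]
  exact sum_congr rfl fun i hi => sum_star_single n M S (star_bondAt n M S hi) _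

/-- the weighted mass of the test field for a bond weight `w`: `Σ_y w y·‖A y‖² = Σ_i w (bondAt x i)·‖c_i‖²`. [folklore] -/
theorem sum_weight_testField {x : Tor (fine n M)} (hx : ¬ blockReg n M S x) (c : Fin d × Bool → ℂ) (w : Tor (fine n M) × Fin d → ℝ) :
    ∑ y : {b // starReg n M S b}, w y.1 * ‖testField n M S x c y‖ ^ 2 = ∑ i ∈ nbrIn n M S x, w (bondAt n M x i) * ‖c i‖ ^ 2 := by
  have e : ∀ y : {b // starReg n M S b}, w y.1 * ‖testField n M S x c y‖ ^ 2
      = ∑ i ∈ nbrIn n M S x, (if y.1 = bondAt n M x i then w (bondAt n M x i) * ‖c i‖ ^ 2 else 0) := fun y => by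
    rw [norm_testField_sq n M S hx c y, mul_sum]
    refine sum_congr rfl fun i _ => ?_
    split_ifs with h
    · rw [h]
    · rw [mul_zero]
  rw [sum_congr rfl fun y _ => e y, sum_comm]
  exact sum_congr rfl fun i hi => sum_star_single n M S (star_bondAt n M S hi) _

/-- **THE CORNER FORM OF THE TEST FIELD** (`2 ≤ n`, `x ∉ Ω`): `re⟨A, C A⟩ = n²·(Σ_i ‖c_i‖² − ‖Σ_i sgnB i·c_i‖²)`. [folklore] -/
theorem re_form_cornerC_testField (hn : 2 ≤ n) {x : Tor (fine n M)} (hx : ¬ blockReg n M S x) (c : Fin d × Bool → ℂ) :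
    (star (testField n M S x c) ⬝ᵥ (cornerC n M S *ᵥ testField n M S x c)).re
      = (n : ℝ) ^ 2 * (∑ i ∈ nbrIn n M S x, ‖c i‖ ^ 2 - ‖∑ i ∈ nbrIn n M S x, sgnB i * c i‖ ^ 2) := by
  rw [re_form_cornerC, extFlux_testField n M S hx, sum_congr rfl fun y _ => by rw [cnt1_own_eq_bdW n M S hn y],
    sum_weight_testField n M S hx c, sum_congr rfl fun i hi => by rw [bdW_one_bondAt n M S hx hi, one_mul]]
  ring

/-! ## §3 The ENDs: both corner bounds are attained; `C = 0 ↔ H1` -/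

/-- **THE SIGN FIELD ATTAINS THE LOWER BOUND**: with `c = sgnB` (all `m = nbrCount x` attached bonds, signed so that the fluxes ADD),
`re⟨A, C A⟩ = −(m − 1)·n²·‖A‖²` and `‖A‖² = m`. [folklore] -/
theorem re_form_cornerC_signField (hn : 2 ≤ n) {x : Tor (fine n M)} (hx : ¬ blockReg n M S x) :
    (star (testField n M S x sgnB) ⬝ᵥ (cornerC n M S *ᵥ testField n M S x sgnB)).re
        = -(((nbrCount n M S x : ℝ) - 1) * (n : ℝ) ^ 2) * nsq (testField n M S x sgnB)
      ∧ nsq (testField n M S x sgnB) = nbrCount n M S x := by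
  have hc : (nbrIn n M S x).card = nbrCount n M S x := rfl
  have hns : nsq (testField n M S x sgnB) = nbrCount n M S x := by
    rw [nsq_testField n M S hx]
    simp only [norm_sgnB, one_pow, sum_const, nsmul_eq_mul, mul_one, hc]
  refine ⟨?_, hns⟩
  rw [re_form_cornerC_testField n M S hn hx, hns]
  simp only [sgnB_mul_self, norm_sgnB, one_pow, sum_const, nsmul_eq_mul, mul_one, Complex.norm_natCast, hc]
  ring

/-- **A DIPOLE ATTAINS THE UPPER BOUND**: two attached bonds `i₀ ≠ i₁` with opposite fluxes give `re⟨A, C A⟩ = n²·‖A‖²`, `‖A‖² = 2`. [folklore] -/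
theorem re_form_cornerC_dipole (hn : 2 ≤ n) {x : Tor (fine n M)} (hx : ¬ blockReg n M S x) {i₀ i₁ : Fin d × Bool}
    (h₀ : i₀ ∈ nbrIn n M S x) (h₁ : i₁ ∈ nbrIn n M S x) (hne : i₀ ≠ i₁) :
    let c : Fin d × Bool → ℂ := fun i => if i = i₀ then sgnB i₀ else if i = i₁ then -sgnB i₁ else 0
    (star (testField n M S x c) ⬝ᵥ (cornerC n M S *ᵥ testField n M S x c)).re = (n : ℝ) ^ 2 * nsq (testField n M S x c)
      ∧ nsq (testField n M S x c) = 2 := by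
  intro c
  -- the two sums over `nbrIn x`
  have hsum1 : ∑ i ∈ nbrIn n M S x, ‖c i‖ ^ 2 = 2 := by
    rw [← Finset.add_sum_erase _ _ h₀, ← Finset.add_sum_erase _ _ (Finset.mem_erase.mpr ⟨hne.symm, h₁⟩)]
    have hrest : ∑ i ∈ ((nbrIn n M S x).erase i₀).erase i₁, ‖c i‖ ^ 2 = 0 := sum_eq_zero fun i hi => by
      have hi1 : i ≠ i₁ := (Finset.mem_erase.mp hi).1
      have hi0 : i ≠ i₀ := (Finset.mem_erase.mp (Finset.mem_erase.mp hi).2).1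
      simp only [c, if_neg hi1, if_neg hi0, norm_zero, zero_pow two_ne_zero]
    rw [hrest, add_zero]
    norm_num [c, hne.symm, norm_sgnB]
  have hsum2 : ∑ i ∈ nbrIn n M S x, sgnB i * c i = 0 := by
    rw [← Finset.add_sum_erase _ _ h₀, ← Finset.add_sum_erase _ _ (Finset.mem_erase.mpr ⟨hne.symm, h₁⟩)]
    have hrest : ∑ i ∈ ((nbrIn n M S x).erase i₀).erase i₁, sgnB i * c i = 0 := sum_eq_zero fun i hi => by
      have hi1 : i ≠ i₁ := (Finset.mem_erase.mp hi).1
      have hi0 : i ≠ i₀ := (Finset.mem_erase.mp (Finset.mem_erase.mp hi).2).1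
      simp only [c, if_neg hi1, if_neg hi0, mul_zero]
    rw [hrest, add_zero]
    norm_num [c, hne.symm, sgnB_mul_self]
  have hns : nsq (testField n M S x c) = 2 := by rw [nsq_testField n M S hx, hsum1]
  refine ⟨?_, hns⟩
  rw [re_form_cornerC_testField n M S hn hx, hsum1, hsum2, hns, norm_zero, zero_pow two_ne_zero, sub_zero]

/-- the form is dominated by the norm: `re⟨A, C A⟩ ≤ ‖C‖·‖A‖²` and `−re⟨A, C A⟩ ≤ ‖C‖·‖A‖²`. [folklore] -/
theorem abs_re_form_le_opNorm (A : {b // starReg n M S b} → ℂ) :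
    |(star A ⬝ᵥ (cornerC n M S *ᵥ A)).re| ≤ ‖cornerC n M S‖ * nsq A := by
  refine (Complex.abs_re_le_norm _).trans ((norm_star_dotProduct_le _ _).trans ?_)
  have h1 : Real.sqrt (nsq (cornerC n M S *ᵥ A)) ≤ ‖cornerC n M S‖ * Real.sqrt (nsq A) := by
    rw [← Real.sqrt_sq (norm_nonneg (cornerC n M S)), ← Real.sqrt_mul (sq_nonneg _)]
    exact Real.sqrt_le_sqrt (nsq_mulVec_le _ _)
  calc Real.sqrt (nsq A) * Real.sqrt (nsq (cornerC n M S *ᵥ A))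
      ≤ Real.sqrt (nsq A) * (‖cornerC n M S‖ * Real.sqrt (nsq A)) := mul_le_mul_of_nonneg_left h1 (Real.sqrt_nonneg _)
    _ = ‖cornerC n M S‖ * nsq A := by
        rw [mul_left_comm, Real.mul_self_sqrt (nsq_nonneg A)]

/-- **`n² ≤ ‖C‖` AS SOON AS ONE EXTERIOR SITE HAS TWO `Ω`-NEIGHBOURS** (`2 ≤ n`). [folklore] -/
theorem le_opNorm_cornerC (hn : 2 ≤ n) {x : Tor (fine n M)} (hx : ¬ blockReg n M S x) (h2 : 2 ≤ nbrCount n M S x) :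
    (n : ℝ) ^ 2 ≤ ‖cornerC n M S‖ := by
  have h2' : 1 < (nbrIn n M S x).card := by unfold nbrCount at h2; omega
  obtain ⟨i₀, h₀, i₁, h₁, hne⟩ := Finset.one_lt_card.mp h2'
  obtain ⟨hform, hns⟩ := re_form_cornerC_dipole n M S hn hx h₀ h₁ hne
  set A := testField n M S x (fun i => if i = i₀ then sgnB i₀ else if i = i₁ then -sgnB i₁ else 0) with hA
  have h := (le_abs_self _).trans (abs_re_form_le_opNorm n M S A)
  rw [hform, hns] at h
  linarith

/-- **`(m − 1)·n² ≤ ‖C‖`** for every exterior site with `m` neighbours in `Ω` (`2 ≤ n`). [folklore] -/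
theorem mul_le_opNorm_cornerC (hn : 2 ≤ n) {x : Tor (fine n M)} (hx : ¬ blockReg n M S x) (h1 : 1 ≤ nbrCount n M S x) :
    ((nbrCount n M S x : ℝ) - 1) * (n : ℝ) ^ 2 ≤ ‖cornerC n M S‖ := by
  obtain ⟨hform, hns⟩ := re_form_cornerC_signField n M S hn hx
  have hneg := (neg_le_abs _).trans (abs_re_form_le_opNorm n M S (testField n M S x sgnB))
  rw [hform, hns, neg_mul, neg_neg] at hneg
  have hm : (0 : ℝ) < nbrCount n M S x := by exact_mod_cast h1
  exact le_of_mul_le_mul_right hneg hm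

/-- **THE LOCAL ELECTRIC OPERATOR IS COMPONENTWISE EXACTLY ON THE REGIONS WITHOUT RE-ENTRANT CONTACT**: `C = 0 ↔ AtMostOneNeighbour` (`2 ≤ n`).
[folklore] -/
theorem cornerC_eq_zero_iff (hn : 2 ≤ n) : cornerC n M S = 0 ↔ AtMostOneNeighbour n M S := by
  refine ⟨fun h0 => (atMostOneNeighbour_iff n M S).mpr fun x hx => ?_, cornerC_eq_zero n M S⟩
  by_contra h2
  have h := le_opNorm_cornerC n M S hn hx (by omega)
  rw [h0, norm_zero] at h
  have : (0 : ℝ) < (n : ℝ) ^ 2 := by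
    have : (2 : ℝ) ≤ n := by exact_mod_cast hn
    positivity
  linarith

end Region

end Summit.QuantumFields.BalabanUV.T4Continuum.RegionCornerCouplingSharp

end
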